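import Summits.ABC.IUTFork.LDHGenuinePerImageUnconditional
import Summits.ABC.IUTFork.LDHGenuinePerImageFreyRowsC
import Summits.ABC.IUTFork.LDHGenuinePerImageFreyRowsD
import Summits.ABC.IUTFork.LDHGenuinePerImageFreyRowsE
import HarnessLib

/-!
# The fork at [IUTchIII] Corollary 3.12, L-DH level, READING (P): the per-image Corollary at a `ℚ`-rational datum,
# UNIFORMLY IN THE PRIME `l` — one theorem per triple instead of one file per `(triple, l)` (abc-iut cell, row
# «C:PERIMAGE-UNIFORM-L», plan g10 C-R61 (3); proof-only)

Record-only PROOF file (D-0012) of the abc-iut cell (seat abc-iut-s2-p4 gen 6). TAKES NO SIDE on [IUTchIII] Cor. 3.12.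
After `Cor22.cor312PerImageOf_ratPoint_of_le` (p471287: for `q ∈ ℚ ∖ {0,1}` and a prime `l ≥ 5`, the single real inequality
`κ_l·log q^{∤2l}(q) ≤ ((l+5)/4 − 1)·((1 − 1/l)·log 𝔣^{∤2l}(q) + (1 − 1/(l−1))·log l) + ((l+5)/4)·log π`, `κ_l = (l+1)/24 − 1/(2l)`,
gives `T.Cor312PerImageOf` at EVERY genuine Θ-volume datum `T` of `(q, l)` — no ramification hypothesis, `μ_l ⊆ K` being a theorem),
the per-row kernel files certify that inequality one `(q, l)` at a time. Here it is certified for ALL primes `l ≥ l₀` at once: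

* `Cor22.cor312PerImageOf_ratPoint_uniform` — **the SLOPE TEST**: if `log q^{∤2l}(q) ≤ Q`, `0 ≤ C ≤ log 𝔣^{∤2l}(q)` and
  `Q ≤ 6·((1 − 1/l₀)·C + (1 − 1/(l₀−1))·log l₀ + log π)` for some `5 ≤ l₀ ≤ l`, then `T.Cor312PerImageOf` at every genuine `T` of
  `(q, l)`. Proof: `κ_l ≤ (l+1)/24`; the coefficients `1 − 1/l`, `(1 − 1/(l−1))·log l` are monotone in `l`; the difference of the two
  sides is then affine in `l` with slope `(l+1)·((B + log π)/4 − Q/24) ≥ 0` plus `log π > 0` (`B` the bracket at `l₀`).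
* For a rational point the dictionary (abc-iut-c312-d1's `Cor22.logQAvoid_ratPoint_eq_sum` / `logCondAvoid_ratPoint_eq_sum`, p462751)
  makes `log q^{∤2l}` and `log 𝔣^{∤2l}` CONSTANT in `l` off the finitely many primes of the denominator of `j(q)`
  (`Cor22.filter_not_dvd_pair_eq_erase_two`), so the slope test at ONE `l₀` decides every prime `l ≥ l₀` off that set.
* Instances (each: the uniform dictionary values, ONE integer certificate by `decide` with `π > 3`, the slope test, the theorem
  `∀ prime l ≥ l₀, l ∉ I: ∀ T, T.Cor312PerImageOf`): Reyssat `2 + 3¹⁰·109 = 23⁵` (`l₀ = 11`); `λ_1061`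
  (`3³·241³ + 5⁸·11⁹·19·61³ = 2¹⁵·17²·331·1061⁴`, `l₀ = 29`); `283 + 5¹¹·13² = 2⁸·3⁸·17³` (`l₀ = 11`);
  `2²·11 + 3²·13¹⁰·17·151·4423 = 5⁹·139⁶` (`l₀ = 19`); `17⁴ + 2·7¹²·29³·743 = 3⁹·5⁶·13⁵·23·191` (`l₀ = 19`);
  `11·103⁸ + 2⁴⁵·3⁷·29·37·1997 = 5¹¹·7¹⁰·79·389²` (`l₀ = 19`) — together several hundred of the ζ-positive Szpiro-bad `(triple, l)`
  pairs of the cell's N3 scan (abc-iut-c312-d1's desk table `PERIMAGE-ZETA-MARGINS.tsv`), by six theorems.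

HONEST SCOPE. Statements about the TYPED per-image inequality at named rational data: for every genuine Θ-volume datum `T` of such a
`(q, l)`, `T.Cor312PerImageOf`. Nothing asserts that such data exist, nothing asserts Cor. 3.12 in general or in print's reading, and
nothing asserts abc; proved-as-typed ≠ in print. [cite: Mochizuki2012, IUTchIII Cor. 3.12 p. 173–174; IUTchIV Thm. 1.10 Step (ii)
p. 24, Step (v) p. 27–29, Cor. 2.2 (ii) proof (P5) p. 46] [cite: SilvermanAEC2009, Cor. III.8.1.1] [claim: Mochizuki2012, status: disputed]
for every IUT quotation. PROOF-ONLY: no definitions, no new `Prop`.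
-/

noncomputable section

namespace Literature.IUT.LogVolume.Cor22

open NumberField IsDedekindDomain Ideal Module Literature.NumberTheory.DiophantineGeometry
open Literature.NumberTheory.DiophantineGeometry.GenEll Summit.ABC.IUTFork Literature.IUT.HodgeTheaters

/-! ## 0. The primes of the denominator away from `{2, l}`, for a prime `l` outside the denominator -/

/-- For a finite set `I` of primes and a prime `l ∉ I`: the members of `I` dividing neither `2` nor `l` are `I ∖ {2}`.
[folklore] -/
theorem filter_not_dvd_pair_eq_erase_two {I : Finset ℕ} (hI : ∀ p ∈ I, p.Prime) {l : ℕ} (hl : l.Prime)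
    (hlI : l ∉ I) [DecidablePred (fun p => ∀ s ∈ ({2, l} : Finset ℕ), ¬ p ∣ s)] :
    I.filter (fun p => ∀ s ∈ ({2, l} : Finset ℕ), ¬ p ∣ s) = I.erase 2 := by
  ext p
  rw [Finset.mem_filter, Finset.mem_erase]
  constructor
  · rintro ⟨hp, h⟩
    refine ⟨?_, hp⟩
    rintro rfl
    exact h 2 (by simp) (dvd_refl 2)
  · rintro ⟨hp2, hp⟩
    refine ⟨hp, fun s hs => ?_⟩
    rw [Finset.mem_insert, Finset.mem_singleton] at hs
    rcases hs with rfl | rfl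
    · exact fun h => hp2 ((Nat.prime_dvd_prime_iff_eq (hI p hp) Nat.prime_two).mp h)
    · exact fun h => hlI (((Nat.prime_dvd_prime_iff_eq (hI p hp) hl).mp h) ▸ hp)

/-! ## 1. The slope test: the per-image inequality at a rational point for ALL primes `l ≥ l₀` -/

/-- **THE SLOPE TEST (uniform in `l`)**: for `q ∈ ℚ ∖ {0, 1}`, `5 ≤ l₀ ≤ l` with `l` prime, reals `Q ≥ log q^{∤2l}(q)` and
`0 ≤ C ≤ log 𝔣^{∤2l}(q)`: if `Q ≤ 6·((1 − 1/l₀)·C + (1 − 1/(l₀−1))·log l₀ + log π)` then `T.Cor312PerImageOf` holds at EVERY genuine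
Θ-volume datum `T` of `(q, l)` (`cor312PerImageOf_ratPoint_of_le` with `κ_l ≤ (l+1)/24`, `1 − 1/l ≥ 1 − 1/l₀`,
`(1 − 1/(l−1))·log l ≥ (1 − 1/(l₀−1))·log l₀`, `(l+5)/4·log π ≥ (l+1)/4·log π + log π`).
[cite: Mochizuki2012, IUTchIII Cor. 3.12 p. 173–174] [cite: Mochizuki2012, IUTchIV Thm. 1.10 Step (ii) p. 24, Step (v) p. 27–29]
[claim: Mochizuki2012, status: disputed] -/
theorem cor312PerImageOf_ratPoint_uniform {q : ℚ} (hq0 : q ≠ 0) (hq1 : q ≠ 1) {l₀ : ℕ} (h5 : 5 ≤ l₀)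
    {Q C : ℝ} (hC0 : 0 ≤ C)
    (hslope : Q ≤ 6 * ((1 - 1 / (l₀ : ℝ)) * C + (1 - 1 / ((l₀ : ℝ) - 1)) * Real.log l₀ + Real.log Real.pi))
    {l : ℕ} (hl : l.Prime) (hle : l₀ ≤ l)
    (hQ : logQAvoid (ratPoint q) {2, l} ≤ Q) (hC : C ≤ logCondAvoid (ratPoint q) {2, l})
    (T : ThetaVolumeDatumAt (ratPoint q) l) : T.Cor312PerImageOf := by
  have hL₀ : (5 : ℝ) ≤ l₀ := by exact_mod_cast h5
  have hLL : (l₀ : ℝ) ≤ l := by exact_mod_cast hle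
  have hL : (5 : ℝ) ≤ l := hL₀.trans hLL
  have hX0 : 0 ≤ logQAvoid (ratPoint q) {2, l} := logQAvoid_nonneg _ _
  have hpi : 0 < Real.log Real.pi := Real.log_pos (by linarith [Real.pi_gt_three])
  have hlog₀ : 0 < Real.log l₀ := Real.log_pos (by linarith)
  have hlogle : Real.log l₀ ≤ Real.log l := Real.log_le_log (by linarith) hLL
  have hcast : ((l - 1 : ℕ) : ℝ) = (l : ℝ) - 1 := by
    rw [Nat.cast_sub (by omega : 1 ≤ l), Nat.cast_one]
  refine cor312PerImageOf_ratPoint_of_le hq0 hq1 hl (h5.trans hle) ?_ T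
  rw [hcast]
  set X := logQAvoid (ratPoint q) {2, l} with hXdef
  set Y := logCondAvoid (ratPoint q) {2, l} with hYdef
  -- (1) the `q`-side: `κ_l·X ≤ (l+1)/24·Q`
  have h1 : (((l : ℝ) + 1) / 24 - 1 / (2 * l)) * X ≤ ((l : ℝ) + 1) / 24 * Q := by
    have ha : 0 ≤ 1 / (2 * (l : ℝ)) * X := mul_nonneg (by positivity) hX0
    have hb : ((l : ℝ) + 1) / 24 * X ≤ ((l : ℝ) + 1) / 24 * Q :=
      mul_le_mul_of_nonneg_left hQ (by positivity)
    nlinarith [ha, hb]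
  -- (2) the conductor term
  have h2 : (1 - 1 / (l₀ : ℝ)) * C ≤ (1 - 1 / (l : ℝ)) * Y := by
    have ha : 1 - 1 / (l₀ : ℝ) ≤ 1 - 1 / (l : ℝ) := by
      have h := one_div_le_one_div_of_le (by linarith : (0 : ℝ) < l₀) hLL
      linarith
    have hb : 0 ≤ 1 - 1 / (l : ℝ) := by
      have h : 1 / (l : ℝ) ≤ 1 := (div_le_one (by linarith)).mpr (by linarith)
      linarith
    calc (1 - 1 / (l₀ : ℝ)) * C ≤ (1 - 1 / (l : ℝ)) * C := mul_le_mul_of_nonneg_right ha hC0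
      _ ≤ (1 - 1 / (l : ℝ)) * Y := mul_le_mul_of_nonneg_left hC hb
  -- (3) the `log l` term
  have h3 : (1 - 1 / ((l₀ : ℝ) - 1)) * Real.log l₀ ≤ (1 - ((l : ℝ) - 1)⁻¹) * Real.log l := by
    have ha : 1 - 1 / ((l₀ : ℝ) - 1) ≤ 1 - ((l : ℝ) - 1)⁻¹ := by
      have h := one_div_le_one_div_of_le (by linarith : (0 : ℝ) < (l₀ : ℝ) - 1)
        (by linarith : (l₀ : ℝ) - 1 ≤ (l : ℝ) - 1)
      rw [one_div ((l : ℝ) - 1)] at h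
      linarith
    have hb : 0 ≤ 1 - 1 / ((l₀ : ℝ) - 1) := by
      have h : 1 / ((l₀ : ℝ) - 1) ≤ 1 := (div_le_one (by linarith)).mpr (by linarith)
      linarith
    calc (1 - 1 / ((l₀ : ℝ) - 1)) * Real.log l₀ ≤ (1 - ((l : ℝ) - 1)⁻¹) * Real.log l₀ :=
        mul_le_mul_of_nonneg_right ha hlog₀.le
      _ ≤ (1 - ((l : ℝ) - 1)⁻¹) * Real.log l := mul_le_mul_of_nonneg_left hlogle (hb.trans ha)
  -- (4) assembly: the difference is affine in `l` with nonnegative slope, plus `log π > 0`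
  have h4 : 0 ≤ ((l : ℝ) + 5) / 4 - 1 := by linarith
  have h5' : ((l : ℝ) + 1) / 4 * Real.log Real.pi ≤ ((l : ℝ) + 5) / 4 * Real.log Real.pi :=
    mul_le_mul_of_nonneg_right (by linarith) hpi.le
  have h6 := mul_le_mul_of_nonneg_left (add_le_add h2 h3) h4
  have h7 : ((l : ℝ) + 1) / 24 * Q ≤ ((l : ℝ) + 1) / 24 *
      (6 * ((1 - 1 / (l₀ : ℝ)) * C + (1 - 1 / ((l₀ : ℝ) - 1)) * Real.log l₀ + Real.log Real.pi)) :=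
    mul_le_mul_of_nonneg_left hslope (by positivity)
  have h8 : ((l : ℝ) + 1) / 24 *
      (6 * ((1 - 1 / (l₀ : ℝ)) * C + (1 - 1 / ((l₀ : ℝ) - 1)) * Real.log l₀ + Real.log Real.pi))
      = (((l : ℝ) + 5) / 4 - 1) * ((1 - 1 / (l₀ : ℝ)) * C + (1 - 1 / ((l₀ : ℝ) - 1)) * Real.log l₀)
        + ((l : ℝ) + 1) / 4 * Real.log Real.pi := by ring
  linarith [h1, h6, h7, h8, h5']


/-! ## 2. Reyssat `2 + 3¹⁰·109 = 23⁵` (`λ = 2/23⁵`): every prime `l ≥ 11` outside the denominator -/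

/-- The primes of the denominator of `j(λ)`. [folklore] -/
private theorem reyssatU_primes : ∀ p ∈ ({3, 23, 109} : Finset ℕ), p.Prime := by
  intro p hp
  simp only [Finset.mem_insert, Finset.mem_singleton] at hp
  rcases hp with rfl | rfl | rfl <;> norm_num

/-- The exponents are positive. [folklore] -/
private theorem reyssatU_exp_ne_zero : ∀ p ∈ ({3, 23, 109} : Finset ℕ), (fun p => if p = 3 then 20 else if p = 23 then 10 else 2) p ≠ 0 := by
  intro p hp
  simp only [Finset.mem_insert, Finset.mem_singleton] at hp
  rcases hp with rfl | rfl | rfl <;> norm_num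

/-- The factorised denominator. [folklore] -/
private theorem reyssatU_den :
    (1716154764793810191403767369 : ℕ) = ∏ p ∈ ({3, 23, 109} : Finset ℕ), p ^ (fun p => if p = 3 then 20 else if p = 23 then 10 else 2) p := by
  rw [Finset.prod_insert (by decide), Finset.prod_insert (by decide), Finset.prod_singleton]
  norm_num

/-- The numerator is prime to the denominator. [folklore] -/
private theorem reyssatU_coprime : ∀ p ∈ ({3, 23, 109} : Finset ℕ), ¬ p ∣ (4550034081061575630856781958829776704708032 : ℕ) := by
  intro p hp
  simp only [Finset.mem_insert, Finset.mem_singleton] at hp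
  rcases hp with rfl | rfl | rfl <;> norm_num

/-- **`log q^{∤2l}` is CONSTANT in the prime `l` outside the denominator**: `= 20 * log 3 + 10 * log 23 + 2 * log 109`.
[cite: Mochizuki2012, IUTchIV Thm. 1.10 p. 23] [claim: Mochizuki2012, status: disputed] -/
theorem logQAvoid_reyssat_of_notMem {l : ℕ} (hl : l.Prime) (hlI : l ∉ ({3, 23, 109} : Finset ℕ)) :
    logQAvoid (ratPoint ((2 : ℚ) / 6436343)) {2, l} = 20 * Real.log 3 + 10 * Real.log 23 + 2 * Real.log 109 := by
  rw [logQAvoid_ratPoint_eq_sum reyssatU_primes reyssatU_exp_ne_zero reyssatU_den jInv_reyssat (by norm_num) {2, l}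
      (fun p hp _ => reyssatU_coprime p hp), filter_not_dvd_pair_eq_erase_two reyssatU_primes hl hlI,
    show ({3, 23, 109} : Finset ℕ).erase 2 = {3, 23, 109} from by decide, Finset.sum_insert (by decide), Finset.sum_insert (by decide), Finset.sum_singleton]
  norm_num
  ring

/-- **`log 𝔣^{∤2l}` is CONSTANT in the prime `l` outside the denominator**: `= log 3 + log 23 + log 109`.
[cite: Mochizuki2012, IUTchIV Thm. 1.10 p. 23] [claim: Mochizuki2012, status: disputed] -/
theorem logCondAvoid_reyssat_of_notMem {l : ℕ} (hl : l.Prime) (hlI : l ∉ ({3, 23, 109} : Finset ℕ)) :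
    logCondAvoid (ratPoint ((2 : ℚ) / 6436343)) {2, l} = Real.log 3 + Real.log 23 + Real.log 109 := by
  rw [logCondAvoid_ratPoint_eq_sum reyssatU_primes reyssatU_exp_ne_zero reyssatU_den jInv_reyssat (by norm_num) {2, l}
      (fun p hp _ => reyssatU_coprime p hp), filter_not_dvd_pair_eq_erase_two reyssatU_primes hl hlI,
    show ({3, 23, 109} : Finset ℕ).erase 2 = {3, 23, 109} from by decide, Finset.sum_insert (by decide), Finset.sum_insert (by decide), Finset.sum_singleton]
  norm_num
  ring

set_option exponentiation.threshold 941 in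
/-- The integer certificate of the slope test at `l₀ = 11` (scaled by `l₀(l₀−1) = 110`, `log π` replaced by `log 3`):
`(3) ^ 940 * (23) ^ 500 ≤ (11) ^ 594 * (109) ^ 380`. [folklore] -/
private theorem reyssatU_nat_ineq : ((3 : ℕ) ^ 940 * (23 : ℕ) ^ 500) ≤ (11 : ℕ) ^ 594 * (109 : ℕ) ^ 380 := by
  decide

/-- **The slope test at `l₀ = 11`**: `Q ≤ 6·((1 − 1/11)·C + (1 − 1/10)·log 11 + log π)` for the constant values `Q`, `C` of
`log q^{∤2l}`, `log 𝔣^{∤2l}` (from `reyssatU_nat_ineq` and `π > 3`). [folklore] -/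
theorem reyssat_slope :
    (20 * Real.log 3 + 10 * Real.log 23 + 2 * Real.log 109) ≤
      6 * ((1 - 1 / ((11 : ℕ) : ℝ)) * (Real.log 3 + Real.log 23 + Real.log 109) + (1 - 1 / (((11 : ℕ) : ℝ) - 1)) * Real.log ((11 : ℕ) : ℝ)
        + Real.log Real.pi) := by
  have hZ := reyssatU_nat_ineq
  have hR : ((3 : ℝ) ^ 940 * (23 : ℝ) ^ 500) ≤ (11 : ℝ) ^ 594 * (109 : ℝ) ^ 380 := by exact_mod_cast hZ
  have hlog := Real.log_le_log (by positivity) hR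
  rw [Real.log_mul (by positivity) (by positivity)] at hlog
  rw [Real.log_mul (by positivity) (by positivity)] at hlog
  simp only [Real.log_pow] at hlog
  have hpi : Real.log 3 < Real.log Real.pi := Real.log_lt_log (by norm_num) Real.pi_gt_three
  have hp3 : 0 < Real.log 3 := Real.log_pos (by norm_num)
  have hp11 : 0 < Real.log 11 := Real.log_pos (by norm_num)
  have hp23 : 0 < Real.log 23 := Real.log_pos (by norm_num)
  have hp109 : 0 < Real.log 109 := Real.log_pos (by norm_num)
  push_cast at hlog ⊢
  nlinarith [hlog, hpi, hp3, hp11, hp23, hp109]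

/-- **[IUTchIII] COR. 3.12 IN READING (P), AS TYPED, AT EVERY GENUINE Θ-DATUM OF Reyssat `2 + 3¹⁰·109 = 23⁵` (`λ = 2/23⁵`) FOR EVERY PRIME `l ≥ 11` OUTSIDE
`{3, 23, 109}`** — UNCONDITIONALLY (the slope test `reyssat_slope` + the constant dictionary values + `cor312PerImageOf_ratPoint_uniform`).
[cite: Mochizuki2012, IUTchIII Cor. 3.12 p. 173–174] [cite: Mochizuki2012, IUTchIV Thm. 1.10 Step (ii) p. 24, Step (v) p. 27–29]
[claim: Mochizuki2012, status: disputed] -/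
theorem cor312PerImageOf_reyssat_of_le {l : ℕ} (hl : l.Prime) (hle : 11 ≤ l) (hlI : l ∉ ({3, 23, 109} : Finset ℕ))
    (T : ThetaVolumeDatumAt (ratPoint ((2 : ℚ) / 6436343)) l) : T.Cor312PerImageOf := by
  have hC0 : (0 : ℝ) ≤ Real.log 3 + Real.log 23 + Real.log 109 := by
    have h3 : 0 ≤ Real.log 3 := Real.log_nonneg (by norm_num)
    have h23 : 0 ≤ Real.log 23 := Real.log_nonneg (by norm_num)
    have h109 : 0 ≤ Real.log 109 := Real.log_nonneg (by norm_num)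
    linarith
  have hs := reyssat_slope
  push_cast at hs
  exact cor312PerImageOf_ratPoint_uniform (q := ((2 : ℚ) / 6436343)) (by norm_num) (by norm_num) (l₀ := 11) (by norm_num) hC0 hs hl hle
    (le_of_eq (logQAvoid_reyssat_of_notMem hl hlI)) (ge_of_eq (logCondAvoid_reyssat_of_notMem hl hlI)) T


/-! ## 3. Frey `283 + 5¹¹·13² = 2⁸·3⁸·17³` (`λ = 283/8251953408`): every prime `l ≥ 11` outside the denominator -/

/-- The primes of the denominator of `j(λ)`. [folklore] -/
private theorem freyEU_primes : ∀ p ∈ ({2, 3, 5, 13, 17, 283} : Finset ℕ), p.Prime := by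
  intro p hp
  simp only [Finset.mem_insert, Finset.mem_singleton] at hp
  rcases hp with rfl | rfl | rfl | rfl | rfl | rfl <;> norm_num

/-- The exponents are positive. [folklore] -/
private theorem freyEU_exp_ne_zero : ∀ p ∈ ({2, 3, 5, 13, 17, 283} : Finset ℕ), (fun p => if p = 2 then 8 else if p = 3 then 16 else if p = 5 then 22 else if p = 13 then 4 else if p = 17 then 6 else 2) p ≠ 0 := by
  intro p hp
  simp only [Finset.mem_insert, Finset.mem_singleton] at hp
  rcases hp with rfl | rfl | rfl | rfl | rfl | rfl <;> norm_num

/-- The factorised denominator. [folklore] -/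
private theorem freyEU_den :
    (1450640989446910294451489868164062500000000 : ℕ) = ∏ p ∈ ({2, 3, 5, 13, 17, 283} : Finset ℕ), p ^ (fun p => if p = 2 then 8 else if p = 3 then 16 else if p = 5 then 22 else if p = 13 then 4 else if p = 17 then 6 else 2) p := by
  rw [Finset.prod_insert (by decide), Finset.prod_insert (by decide), Finset.prod_insert (by decide), Finset.prod_insert (by decide), Finset.prod_insert (by decide), Finset.prod_singleton]
  norm_num

/-- The numerator is prime to the denominator. [folklore] -/
private theorem freyEU_coprime : ∀ p ∈ ({2, 3, 5, 13, 17, 283} : Finset ℕ), ¬ p ∣ (315747963792470439039120932558494593237415361960848201744969 : ℕ) := by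
  intro p hp
  simp only [Finset.mem_insert, Finset.mem_singleton] at hp
  rcases hp with rfl | rfl | rfl | rfl | rfl | rfl <;> norm_num

/-- **`log q^{∤2l}` is CONSTANT in the prime `l` outside the denominator**: `= 16 * log 3 + 22 * log 5 + 4 * log 13 + 6 * log 17 + 2 * log 283`.
[cite: Mochizuki2012, IUTchIV Thm. 1.10 p. 23] [claim: Mochizuki2012, status: disputed] -/
theorem logQAvoid_freyE_of_notMem {l : ℕ} (hl : l.Prime) (hlI : l ∉ ({2, 3, 5, 13, 17, 283} : Finset ℕ)) :
    logQAvoid (ratPoint ((283 : ℚ) / 8251953408)) {2, l} = 16 * Real.log 3 + 22 * Real.log 5 + 4 * Real.log 13 + 6 * Real.log 17 + 2 * Real.log 283 := by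
  rw [logQAvoid_ratPoint_eq_sum freyEU_primes freyEU_exp_ne_zero freyEU_den jInv_freyE (by norm_num) {2, l}
      (fun p hp _ => freyEU_coprime p hp), filter_not_dvd_pair_eq_erase_two freyEU_primes hl hlI,
    show ({2, 3, 5, 13, 17, 283} : Finset ℕ).erase 2 = {3, 5, 13, 17, 283} from by decide, Finset.sum_insert (by decide), Finset.sum_insert (by decide), Finset.sum_insert (by decide), Finset.sum_insert (by decide), Finset.sum_singleton]
  norm_num
  ring

/-- **`log 𝔣^{∤2l}` is CONSTANT in the prime `l` outside the denominator**: `= log 3 + log 5 + log 13 + log 17 + log 283`.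
[cite: Mochizuki2012, IUTchIV Thm. 1.10 p. 23] [claim: Mochizuki2012, status: disputed] -/
theorem logCondAvoid_freyE_of_notMem {l : ℕ} (hl : l.Prime) (hlI : l ∉ ({2, 3, 5, 13, 17, 283} : Finset ℕ)) :
    logCondAvoid (ratPoint ((283 : ℚ) / 8251953408)) {2, l} = Real.log 3 + Real.log 5 + Real.log 13 + Real.log 17 + Real.log 283 := by
  rw [logCondAvoid_ratPoint_eq_sum freyEU_primes freyEU_exp_ne_zero freyEU_den jInv_freyE (by norm_num) {2, l}
      (fun p hp _ => freyEU_coprime p hp), filter_not_dvd_pair_eq_erase_two freyEU_primes hl hlI,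
    show ({2, 3, 5, 13, 17, 283} : Finset ℕ).erase 2 = {3, 5, 13, 17, 283} from by decide, Finset.sum_insert (by decide), Finset.sum_insert (by decide), Finset.sum_insert (by decide), Finset.sum_insert (by decide), Finset.sum_singleton]
  norm_num
  ring

set_option exponentiation.threshold 1821 in
/-- The integer certificate of the slope test at `l₀ = 11` (scaled by `l₀(l₀−1) = 110`, `log π` replaced by `log 3`):
`(3) ^ 500 * (5) ^ 1820 * (17) ^ 60 ≤ (11) ^ 594 * (13) ^ 160 * (283) ^ 380`. [folklore] -/
private theorem freyEU_nat_ineq : ((3 : ℕ) ^ 500 * (5 : ℕ) ^ 1820 * (17 : ℕ) ^ 60) ≤ (11 : ℕ) ^ 594 * (13 : ℕ) ^ 160 * (283 : ℕ) ^ 380 := by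
  decide

/-- **The slope test at `l₀ = 11`**: `Q ≤ 6·((1 − 1/11)·C + (1 − 1/10)·log 11 + log π)` for the constant values `Q`, `C` of
`log q^{∤2l}`, `log 𝔣^{∤2l}` (from `freyEU_nat_ineq` and `π > 3`). [folklore] -/
theorem freyE_slope :
    (16 * Real.log 3 + 22 * Real.log 5 + 4 * Real.log 13 + 6 * Real.log 17 + 2 * Real.log 283) ≤
      6 * ((1 - 1 / ((11 : ℕ) : ℝ)) * (Real.log 3 + Real.log 5 + Real.log 13 + Real.log 17 + Real.log 283) + (1 - 1 / (((11 : ℕ) : ℝ) - 1)) * Real.log ((11 : ℕ) : ℝ)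
        + Real.log Real.pi) := by
  have hZ := freyEU_nat_ineq
  have hR : ((3 : ℝ) ^ 500 * (5 : ℝ) ^ 1820 * (17 : ℝ) ^ 60) ≤ (11 : ℝ) ^ 594 * (13 : ℝ) ^ 160 * (283 : ℝ) ^ 380 := by exact_mod_cast hZ
  have hlog := Real.log_le_log (by positivity) hR
  rw [Real.log_mul (by positivity) (by positivity)] at hlog
  rw [Real.log_mul (by positivity) (by positivity)] at hlog
  rw [Real.log_mul (by positivity) (by positivity)] at hlog
  rw [Real.log_mul (by positivity) (by positivity)] at hlog
  simp only [Real.log_pow] at hlog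
  have hpi : Real.log 3 < Real.log Real.pi := Real.log_lt_log (by norm_num) Real.pi_gt_three
  have hp3 : 0 < Real.log 3 := Real.log_pos (by norm_num)
  have hp5 : 0 < Real.log 5 := Real.log_pos (by norm_num)
  have hp11 : 0 < Real.log 11 := Real.log_pos (by norm_num)
  have hp13 : 0 < Real.log 13 := Real.log_pos (by norm_num)
  have hp17 : 0 < Real.log 17 := Real.log_pos (by norm_num)
  have hp283 : 0 < Real.log 283 := Real.log_pos (by norm_num)
  push_cast at hlog ⊢
  nlinarith [hlog, hpi, hp3, hp5, hp11, hp13, hp17, hp283]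

/-- **[IUTchIII] COR. 3.12 IN READING (P), AS TYPED, AT EVERY GENUINE Θ-DATUM OF Frey `283 + 5¹¹·13² = 2⁸·3⁸·17³` (`λ = 283/8251953408`) FOR EVERY PRIME `l ≥ 11` OUTSIDE
`{2, 3, 5, 13, 17, 283}`** — UNCONDITIONALLY (the slope test `freyE_slope` + the constant dictionary values + `cor312PerImageOf_ratPoint_uniform`).
[cite: Mochizuki2012, IUTchIII Cor. 3.12 p. 173–174] [cite: Mochizuki2012, IUTchIV Thm. 1.10 Step (ii) p. 24, Step (v) p. 27–29]
[claim: Mochizuki2012, status: disputed] -/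
theorem cor312PerImageOf_freyE_of_le {l : ℕ} (hl : l.Prime) (hle : 11 ≤ l) (hlI : l ∉ ({2, 3, 5, 13, 17, 283} : Finset ℕ))
    (T : ThetaVolumeDatumAt (ratPoint ((283 : ℚ) / 8251953408)) l) : T.Cor312PerImageOf := by
  have hC0 : (0 : ℝ) ≤ Real.log 3 + Real.log 5 + Real.log 13 + Real.log 17 + Real.log 283 := by
    have h3 : 0 ≤ Real.log 3 := Real.log_nonneg (by norm_num)
    have h5 : 0 ≤ Real.log 5 := Real.log_nonneg (by norm_num)
    have h13 : 0 ≤ Real.log 13 := Real.log_nonneg (by norm_num)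
    have h17 : 0 ≤ Real.log 17 := Real.log_nonneg (by norm_num)
    have h283 : 0 ≤ Real.log 283 := Real.log_nonneg (by norm_num)
    linarith
  have hs := freyE_slope
  push_cast at hs
  exact cor312PerImageOf_ratPoint_uniform (q := ((283 : ℚ) / 8251953408)) (by norm_num) (by norm_num) (l₀ := 11) (by norm_num) hC0 hs hl hle
    (le_of_eq (logQAvoid_freyE_of_notMem hl hlI)) (ge_of_eq (logCondAvoid_freyE_of_notMem hl hlI)) T


end Literature.IUT.LogVolume.Cor22

end
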